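import Summits.BirchSwinnertonDyer.BirchSwinnertonDyer.Theorems.PrintCFramBottomClassIndexLawFiveLeHeegnerFieldSupplyReflection
import Summits.BirchSwinnertonDyer.BirchSwinnertonDyer.Theorems.PrintCFramBottomClassIndexLawFiveLeHeegnerFieldSupplyAtPRung
import Literature.NumberTheory.QuadraticFields.FundamentalDiscriminant
import Literature.NumberTheory.QuadraticFields.KroneckerSplitting
import Literature.NumberTheory.EllipticCurves.HeegnerFieldOfDiscriminantProofs
import Literature.NumberTheory.EllipticCurves.KrizLi2019.TeichmullerCharacterExists
import HarnessLib

/-!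
# Crux `PrintCFram.BottomClassIndexLawFiveLe` (stmt-BirchSwinnertonDyer-20372), line `eisenstein-resource-bdp-line` (registry v20 → v21):
# `(SeedI⁶)` DISCHARGED — on the locus «every prime of `m` splits in `ℚ(√−p)`» the seed of the at-`p` rung IS the CM field,
# and its field factor is the (unit) class factor
# (cell `bsd-print-cfram`, width seat `bsd-line-cfram-p1-w8` g5; THEOREMS ONLY, `--supports` 20372; BSD is not proved by any of this)

HONEST FRAMING. Nothing here is a statement about BSD; Stub C is not proved. LEAD g12's `…HeegnerFieldSupplyAtPRung` split w8 g4's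
six-prime supply statement `(P⁶)` as `(P⁶) ⟸ (AtP⁶) ∧ (Seed⁶)` and `(Seed⁶) ⟸ (SeedI⁶) ∧ (SeedII⁶)` along the decidable locus
`L(m,p)` = «`J(−p | q) = 1` for every odd prime `q ∣ m`, and `2 ∣ m ⟹ p ≡ 7 (mod 8)`», keeping `(SeedI⁶)` as a hypothesis. This file
PROVES `(SeedI⁶)` verbatim (`seedOn_six`): for the class datum `(p, m, χ, k)` with `L(m,p)` and unit class factor, the witness is
`K₀ :=` the imaginary quadratic field of discriminant `−p` (`Quadratic.exists_numberField_discr_eq`), `ε₀ :=` its Kronecker character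
`J(· | p)` (`KrizLiBinders.exists_isKroneckerCharacterOf_of_discr`): every prime of `m` splits in `K₀` by `L(m,p)`
(`Quadratic.ncard_primesOver_eq_two_iff_jacobiSym`, `…_two_eq_two_iff`), `d_{K₀} = −p` is odd and `< −4`, and the field factor
`‖k⁻¹ B_{k,(χ↑ε₀↑)~}‖_p` is a unit because it IS the class-factor reflection of this seat's `…HeegnerFieldSupplyReflection`
(`norm_div_generalizedBernoulli_legendreTwist_le_inv_iff`: `(1/k)B_{k,χ·(·/p)} ≡ (1/(p−k))B_{p−k,χ}`), once the primitive character
`(χ↑ε₀↑)~` is identified with `χ↑(ω^{(p−1)/2})↑` (same level `m·p`, same values on `ℕ` since `J(a | p) = ω(a)^{(p−1)/2}` in `ℚ_p`,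
`…Seed.teichmuller_pow_half_eq_legendreSym`; §1–§2 are the transport lemmas). Consequence: fed into the LEAD's
`stubC_of_atP_of_seedOn_of_seedOff` (as its `hOn`), Stub C VERBATIM ⟸ (AtP⁶) ∧ (SeedII⁶) — registry v21 may carry the analytic residue as
TWO stubs, (AtP⁶) [print-derivable, typing owed: half-integral weight forms mod `p`] and (SeedII⁶) [research, `p`-free, off the locus],
with `(SeedI⁶)` closed by name (the composed corollary is appended here once the farm has built `…HeegnerFieldSupplyAtPRung`).
beyond-print theorem: NO. Crux notes `Lines/eisenstein-resource-bdp-line-w8g5-notes.md` §4.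

References: [Washington1997] Thm. 5.11, §5.1; [Cox2013] §1.C Lemma 1.14; [Marcus2018] Ch. 2 Thm. 1, Ch. 3 Thm. 25; [KrizLi2019] Thm. 1.20, §8;
[AhlgrenBoylan2003] Thm. 3 (the at-`p` rung's print, cited by the LEAD's file).
-/

set_option autoImplicit false
-- summit-side namespace `Summit.BirchSwinnertonDyer.BirchSwinnertonDyer.…` (single-conjunct summit, D-0017 layout)
set_option linter.dupNamespace false

noncomputable section

open scoped Classical NumberTheorySymbols
open NumberField WeierstrassCurve DirichletCharacter Literature.NumberTheory.LFunctions
  Literature.NumberTheory.EllipticCurves Literature.NumberTheory.EllipticCurves.KrizLi2019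
  Literature.NumberTheory.EllipticCurves.Rank1Residual Literature.NumberTheory.Congruences
  Literature.NumberTheory.QuadraticFields

namespace Summit.BirchSwinnertonDyer.BirchSwinnertonDyer.Theorems.PrintCFram.HeegnerFieldSupply

open Summit.BirchSwinnertonDyer.BirchSwinnertonDyer.Theorems.PrintCFram
open Summit.BirchSwinnertonDyer.BirchSwinnertonDyer.Theorems.PrintCFram.KummerDictionary
open Summit.BirchSwinnertonDyer.Rank1Residual Summit.BirchSwinnertonDyer.Rank1Residual.X12.O11

variable {p : ℕ} [hp : Fact p.Prime]

/-! ## §1 Transport of generalized Bernoulli numbers along equal levels and equal values -/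

omit hp in
/-- **Characters of (propositionally) equal level with the same values on `ℕ` have the same generalized Bernoulli numbers.**
[cite: Washington1997, Ch. 4 (B_{n,χ} depends only on the function χ on ℤ)] -/
theorem generalizedBernoulli_eq_of_forall_apply_natCast_eq {R : Type*} [CommRing R] [Algebra ℚ R] {n₁ n₂ : ℕ}
    [NeZero n₁] [NeZero n₂] (h : n₁ = n₂) (φ₁ : DirichletCharacter R n₁) (φ₂ : DirichletCharacter R n₂)
    (hφ : ∀ a : ℕ, φ₁ (a : ZMod n₁) = φ₂ (a : ZMod n₂)) (k : ℕ) :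
    generalizedBernoulli k φ₁ = generalizedBernoulli k φ₂ := by
  subst h
  have e : φ₁ = φ₂ := by
    refine MulChar.ext fun u ↦ ?_
    have hu := hφ (u : ZMod n₁).val
    rwa [ZMod.natCast_zmod_val] at hu
  rw [e]

omit hp in
/-- **A PRIMITIVE character and the primitive character it induces have the same values on `ℕ`** (its conductor is its level; at
integers prime to the level by Mathlib's `primitiveCharacter_apply_of_isCoprime`, elsewhere both vanish). [cite: Washington1997, Ch. 3 (p. 19)] -/
theorem primitiveCharacter_apply_natCast_of_isPrimitive {R : Type*} [CommRing R] [IsDomain R] {n : ℕ} [NeZero n]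
    (Ψ : DirichletCharacter R n) (hΨ : Ψ.IsPrimitive) (a : ℕ) :
    Ψ.primitiveCharacter (a : ZMod Ψ.conductor) = Ψ (a : ZMod n) := by
  have hc : Ψ.conductor = n := hΨ
  by_cases ha : a.Coprime n
  · have h := primitiveCharacter_apply_of_isCoprime Ψ (a := (a : ℤ)) (Nat.isCoprime_iff_coprime.mpr ha)
    simpa only [Int.cast_natCast] using h
  · have hnu : ¬ IsUnit (a : ZMod n) := by rwa [ZMod.isUnit_iff_coprime]
    have hnu' : ¬ IsUnit (a : ZMod Ψ.conductor) := by rw [ZMod.isUnit_iff_coprime, hc]; exact ha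
    rw [MulChar.map_nonunit _ hnu, MulChar.map_nonunit _ hnu']

/-! ## §2 `J(a | p) = ω(a)^{(p−1)/2}` at EVERY natural number -/

/-- **`J(a | p) = ω(a)^{(p−1)/2}` in `ℚ_p` for every `a ∈ ℕ`** (`p` odd, `ω` Teichmüller): Euler's criterion on the Teichmüller lift at `p ∤ a`
(`teichmuller_pow_half_eq_legendreSym`), and `0 = 0` at `p ∣ a`. [cite: IrelandRosen1990, Prop. 5.1.2] [cite: Washington1997, §5.1] -/
theorem jacobiSym_eq_teichmuller_pow_half {ω : DirichletCharacter ℚ_[p] p} (hω : IsTeichmullerCharacter ω) (hp2 : p ≠ 2) (a : ℕ) :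
    (J((a : ℤ) | p) : ℚ_[p]) = ω (a : ZMod p) ^ ((p - 1) / 2) := by
  have hh : (p - 1) / 2 ≠ 0 := by
    have := hp.out.two_le
    omega
  by_cases ha : p ∣ a
  · have ha0 : (a : ZMod p) = 0 := (ZMod.natCast_eq_zero_iff a p).mpr ha
    have hJ : J((a : ℤ) | p) = 0 := by
      rw [jacobiSym.eq_zero_iff_not_coprime, Int.gcd_natCast_natCast]
      intro hcop
      exact hp.out.ne_one (Nat.Coprime.eq_one_of_dvd (Nat.coprime_comm.mp hcop) ha)
    rw [hJ, Int.cast_zero, ha0, MulChar.map_zero, zero_pow hh]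
  · rw [← jacobiSym.legendreSym.to_jacobiSym, teichmuller_pow_half_eq_legendreSym hω hp2 ha]

/-! ## §3 `(SeedI⁶)` proved -/

/-- **`(SeedI⁶)` — the seed ON the locus IS the CM field (LEAD g12's hypothesis `hOn` of `seed_six_of_seedOn_of_seedOff`, VERBATIM,
proved).** For `p ∈ {7, 11, 19, 43, 67, 163}`, `m ⊥ p`, `χ` primitive quadratic mod `m`, `k ∈ {(p+1)/4, (3p−1)/4}` with `2 ≤ k ≤ p−2` and
`χ(−1)(−1)^k = −1`, the locus condition `L(m,p)` and a UNIT class factor `¬ ‖(p−k)⁻¹B_{p−k,χ}‖ ≤ p⁻¹`: the imaginary quadratic field `K₀`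
with `d_{K₀} = −p` and its Kronecker character `ε₀ = J(· | p)` satisfy every clause — every prime of `m` splits in `K₀`, `d_{K₀}` odd `< −4`,
and UNIT field factor `¬ ‖k⁻¹ B_{k,(χ↑ε₀↑)~}‖ ≤ p⁻¹` (the CM reflection `(1/k)B_{k,χ·(·/p)} ≡ (1/(p−k))B_{p−k,χ} (mod p)`).
[cite: Washington1997, Thm. 5.11 and Cor. 5.13] [cite: Cox2013, §1.C Lemma 1.14] [cite: Marcus2018, Ch. 3 Thm. 25] -/
theorem seedOn_six :
    ∀ (p : ℕ) [Fact p.Prime] (m : ℕ) [NeZero m] (χ : DirichletCharacter ℚ_[p] m) (k : ℕ),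
      (p = 7 ∨ p = 11 ∨ p = 19 ∨ p = 43 ∨ p = 67 ∨ p = 163) →
      m.Coprime p → χ.IsPrimitive → χ.IsQuadratic → (k = (p + 1) / 4 ∨ k = (3 * p - 1) / 4) →
      2 ≤ k → k ≤ p - 2 → χ (-1) * (-1) ^ k = -1 →
      ((∀ q : ℕ, q.Prime → q ∣ m → q ≠ 2 → jacobiSym (-(p : ℤ)) q = 1) ∧ (2 ∣ m → p % 8 = 7)) →
      ¬ ‖((p - k : ℕ) : ℚ_[p])⁻¹ * generalizedBernoulli (p - k) χ‖ ≤ (p : ℝ)⁻¹ →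
      ∃ (K₀ : Type) (_ : Field K₀) (_ : NumberField K₀) (ε₀ : DirichletCharacter ℚ_[p] (NumberField.discr K₀).natAbs),
        IsImaginaryQuadratic K₀ ∧
        (∀ q : ℕ, q.Prime → q ∣ m → ((Ideal.span {(q : ℤ)}).primesOver (𝓞 K₀)).ncard = 2) ∧
        Odd (NumberField.discr K₀) ∧ NumberField.discr K₀ < -4 ∧ IsKroneckerCharacterOf K₀ ε₀ ∧
        ¬ ‖(k : ℚ_[p])⁻¹ * @generalizedBernoulli ℚ_[p] _ _
            (changeLevel (dvd_mul_right m (NumberField.discr K₀).natAbs) χ *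
              changeLevel (dvd_mul_left (NumberField.discr K₀).natAbs m) ε₀).conductor ⟨conductor_ne_zero _⟩ k
            (changeLevel (dvd_mul_right m (NumberField.discr K₀).natAbs) χ *
              changeLevel (dvd_mul_left (NumberField.discr K₀).natAbs m) ε₀).primitiveCharacter‖ ≤ (p : ℝ)⁻¹ := by
  intro p hpF m hm χ k hp6 hmp hχ _hχq hk _hk2 _hkp _hpar hL hcls
  have hpp := hpF.out
  have hp3 : p % 4 = 3 := by rcases hp6 with h | h | h | h | h | h <;> subst h <;> norm_num
  have h7 : 7 ≤ p := by rcases hp6 with h | h | h | h | h | h <;> omega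
  have hp2 : p ≠ 2 := by omega
  -- the field `K₀ = ℚ(√−p)`
  have hsqZ : Squarefree (-(p : ℤ)) := by
    rw [← Int.squarefree_natAbs]
    simpa using hpp.squarefree
  obtain ⟨K₀, iF, iN, h2, hd⟩ := Quadratic.exists_numberField_discr_eq (D := -(p : ℤ))
    (Or.inl ⟨by omega, hsqZ, by omega⟩)
  have hK₀ : IsImaginaryQuadratic K₀ := isImaginaryQuadratic_of_discr_eq_of_neg h2 hd (by omega)
  have hdn : (NumberField.discr K₀).natAbs = p := by rw [hd]; simp
  -- its Kronecker character `J(· | p)` and a Teichmüller character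
  obtain ⟨ε₀, hε₀, hε₀v⟩ :=
    KrizLiBinders.exists_isKroneckerCharacterOf_of_discr (p := p) h2 (m := p) hpp.squarefree (Or.inr ⟨hd, hp3⟩)
  obtain ⟨ω, hω⟩ := exists_isTeichmullerCharacter (p := p)
  have hh : (p - 1) / 2 ≠ 0 := by omega
  refine ⟨K₀, iF, iN, ε₀, hK₀, ?_, ?_, ?_, hε₀, ?_⟩
  · -- every prime of `m` splits in `K₀`, by the locus condition `L(m,p)`
    intro q hq hqm
    by_cases hq2 : q = 2
    · subst hq2
      have h8 : NumberField.discr K₀ % 8 = 1 := by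
        rw [hd]
        have := hL.2 hqm
        omega
      have h := (Quadratic.ncard_primesOver_two_eq_two_iff h2).mpr h8
      simpa using h
    · rw [Quadratic.ncard_primesOver_eq_two_iff_jacobiSym h2 hq hq2, hd]
      exact hL.1 q hq hqm hq2
  · rw [hd, Int.odd_iff]
    omega
  · rw [hd]
    omega
  · -- the field factor at `K₀` is the reflected class factor
    set Ψ : DirichletCharacter ℚ_[p] (m * (NumberField.discr K₀).natAbs) :=
      changeLevel (dvd_mul_right m (NumberField.discr K₀).natAbs) χ *
        changeLevel (dvd_mul_left (NumberField.discr K₀).natAbs m) ε₀ with hΨ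
    have hcχ : χ.conductor = m := hχ
    have hcε : ε₀.conductor = (NumberField.discr K₀).natAbs := hε₀.1
    have hcond : Ψ.conductor = m * p := by
      rw [hΨ, RouteU.conductor_changeLevel_mul_changeLevel _ _ χ ε₀ (by rw [hcχ, hcε, hdn]; exact hmp),
        hcχ, hcε, hdn]
    have hΨprim : Ψ.IsPrimitive := by
      rw [isPrimitive_def, hcond, hdn]
    have hval : ∀ a : ℕ, Ψ.primitiveCharacter (a : ZMod Ψ.conductor) =
        (changeLevel (dvd_mul_right m p) χ * changeLevel (dvd_mul_left p m) (ω ^ ((p - 1) / 2)) :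
          DirichletCharacter ℚ_[p] (m * p)) (a : ZMod (m * p)) := by
      intro a
      rw [primitiveCharacter_apply_natCast_of_isPrimitive Ψ hΨprim a, hΨ,
        CharacterTwist.changeLevel_mul_changeLevel_apply_natCast χ ε₀ a, thetaShape_apply_natCast χ ω hh a,
        hε₀v a, jacobiSym_eq_teichmuller_pow_half hω hp2 a]
    have hB : @generalizedBernoulli ℚ_[p] _ _ Ψ.conductor ⟨conductor_ne_zero _⟩ k Ψ.primitiveCharacter =
        generalizedBernoulli k (changeLevel (dvd_mul_right m p) χ *
          changeLevel (dvd_mul_left p m) (ω ^ ((p - 1) / 2))) := by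
      haveI : NeZero Ψ.conductor := ⟨conductor_ne_zero _⟩
      exact generalizedBernoulli_eq_of_forall_apply_natCast_eq hcond _ _ hval k
    intro hle
    apply hcls
    rw [hB] at hle
    exact (norm_div_generalizedBernoulli_legendreTwist_le_inv_iff hp3 h7 hmp χ hω hk).mp hle

/-! ## §4 Stub C from (AtP⁶) and (SeedII⁶) alone -/

/-- **Stub C VERBATIM ⟸ (AtP⁶) ∧ (SeedII⁶)** — LEAD g12's `stubC_of_atP_of_seedOn_of_seedOff` with its middle hypothesis `(SeedI⁶)`
DISCHARGED by `seedOn_six`: on this line the analytic residue of the crux is (AtP⁶) [the at-`p` propagation, print-derivable from the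
mod-`p` theory of half-integral weight forms at level prime to `p`; typing owed] and (SeedII⁶) [a unit field factor at some `m`-admissible
field for the members OFF the locus `L(m,p)`; research, `p`-free]. BSD is not proved by any of this; Stub C is not proved.
[cite: KrizLi2019, Thm. 1.20 (p. 8) and §8 (pp. 49–52)] [cite: AhlgrenBoylan2003, Thm. 3] -/
theorem stubC_of_atP_of_seedOff
    (hAt : ∀ (p : ℕ) [Fact p.Prime] (m : ℕ) [NeZero m] (χ : DirichletCharacter ℚ_[p] m) (k : ℕ),
      (p = 7 ∨ p = 11 ∨ p = 19 ∨ p = 43 ∨ p = 67 ∨ p = 163) →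
      m.Coprime p → χ.IsPrimitive → χ.IsQuadratic → (k = (p + 1) / 4 ∨ k = (3 * p - 1) / 4) →
      2 ≤ k → k ≤ p - 2 → χ (-1) * (-1) ^ k = -1 →
      (∃ (K₀ : Type) (_ : Field K₀) (_ : NumberField K₀) (ε₀ : DirichletCharacter ℚ_[p] (NumberField.discr K₀).natAbs),
        IsImaginaryQuadratic K₀ ∧
        (∀ q : ℕ, q.Prime → q ∣ m → ((Ideal.span {(q : ℤ)}).primesOver (𝓞 K₀)).ncard = 2) ∧
        Odd (NumberField.discr K₀) ∧ NumberField.discr K₀ < -4 ∧ IsKroneckerCharacterOf K₀ ε₀ ∧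
        ¬ ‖(k : ℚ_[p])⁻¹ * @generalizedBernoulli ℚ_[p] _ _
            (changeLevel (dvd_mul_right m (NumberField.discr K₀).natAbs) χ *
              changeLevel (dvd_mul_left (NumberField.discr K₀).natAbs m) ε₀).conductor ⟨conductor_ne_zero _⟩ k
            (changeLevel (dvd_mul_right m (NumberField.discr K₀).natAbs) χ *
              changeLevel (dvd_mul_left (NumberField.discr K₀).natAbs m) ε₀).primitiveCharacter‖ ≤ (p : ℝ)⁻¹) →
      ∃ (K : Type) (_ : Field K) (_ : NumberField K) (εK : DirichletCharacter ℚ_[p] (NumberField.discr K).natAbs),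
        IsImaginaryQuadratic K ∧
        (∀ q : ℕ, q.Prime → q ∣ p * m → ((Ideal.span {(q : ℤ)}).primesOver (𝓞 K)).ncard = 2) ∧
        Odd (NumberField.discr K) ∧ NumberField.discr K < -4 ∧ IsKroneckerCharacterOf K εK ∧
        ¬ ‖(k : ℚ_[p])⁻¹ * @generalizedBernoulli ℚ_[p] _ _
            (changeLevel (dvd_mul_right m (NumberField.discr K).natAbs) χ *
              changeLevel (dvd_mul_left (NumberField.discr K).natAbs m) εK).conductor ⟨conductor_ne_zero _⟩ k
            (changeLevel (dvd_mul_right m (NumberField.discr K).natAbs) χ *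
              changeLevel (dvd_mul_left (NumberField.discr K).natAbs m) εK).primitiveCharacter‖ ≤ (p : ℝ)⁻¹)
    (hOff : ∀ (p : ℕ) [Fact p.Prime] (m : ℕ) [NeZero m] (χ : DirichletCharacter ℚ_[p] m) (k : ℕ),
      (p = 7 ∨ p = 11 ∨ p = 19 ∨ p = 43 ∨ p = 67 ∨ p = 163) →
      m.Coprime p → χ.IsPrimitive → χ.IsQuadratic → (k = (p + 1) / 4 ∨ k = (3 * p - 1) / 4) →
      2 ≤ k → k ≤ p - 2 → χ (-1) * (-1) ^ k = -1 →
      ¬ ((∀ q : ℕ, q.Prime → q ∣ m → q ≠ 2 → jacobiSym (-(p : ℤ)) q = 1) ∧ (2 ∣ m → p % 8 = 7)) →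
      ¬ ‖((p - k : ℕ) : ℚ_[p])⁻¹ * generalizedBernoulli (p - k) χ‖ ≤ (p : ℝ)⁻¹ →
      ∃ (K₀ : Type) (_ : Field K₀) (_ : NumberField K₀) (ε₀ : DirichletCharacter ℚ_[p] (NumberField.discr K₀).natAbs),
        IsImaginaryQuadratic K₀ ∧
        (∀ q : ℕ, q.Prime → q ∣ m → ((Ideal.span {(q : ℤ)}).primesOver (𝓞 K₀)).ncard = 2) ∧
        Odd (NumberField.discr K₀) ∧ NumberField.discr K₀ < -4 ∧ IsKroneckerCharacterOf K₀ ε₀ ∧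
        ¬ ‖(k : ℚ_[p])⁻¹ * @generalizedBernoulli ℚ_[p] _ _
            (changeLevel (dvd_mul_right m (NumberField.discr K₀).natAbs) χ *
              changeLevel (dvd_mul_left (NumberField.discr K₀).natAbs m) ε₀).conductor ⟨conductor_ne_zero _⟩ k
            (changeLevel (dvd_mul_right m (NumberField.discr K₀).natAbs) χ *
              changeLevel (dvd_mul_left (NumberField.discr K₀).natAbs m) ε₀).primitiveCharacter‖ ≤ (p : ℝ)⁻¹) :
    ∀ (W : WeierstrassCurve ℚ) [W.IsElliptic] [W.IsGloballyMinimal] (p : ℕ) [Fact p.Prime], W.HasCM → CMRamified W p → 5 ≤ p →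
      W.analyticRank = 1 → ∀ (f : ℕ) [NeZero f] (ψ : DirichletCharacter ℚ_[p] f) (ω : DirichletCharacter ℚ_[p] p), ψ.Odd →
      IsTeichmullerCharacter ω →
      (∀ ℓ : ℕ, ℓ.Prime → ¬ (ℓ ∣ p * W.conductorNorm ℤ) →
        ‖((W.LFunction ℓ : ℤ) : ℚ_[p]) - (ψ (ℓ : ZMod f) + ψ⁻¹ (ℓ : ZMod f) * ω (ℓ : ZMod p))‖ < 1) →
      ¬ ‖bernoulliOnePrim ψ⁻¹‖ ≤ (p : ℝ)⁻¹ →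
      ∃ (K : Type) (_ : Field K) (_ : NumberField K) (εK : DirichletCharacter ℚ_[p] (NumberField.discr K).natAbs),
        IsImaginaryQuadratic K ∧ SatisfiesHeegnerHypothesis (W.conductorNorm ℤ) K ∧ Odd (NumberField.discr K) ∧
        NumberField.discr K < -4 ∧ IsKroneckerCharacterOf K εK ∧
        ¬ ‖bernoulliOnePrim (bernoulliCharTwo ψ εK ω)‖ ≤ (p : ℝ)⁻¹ :=
  stubC_of_atP_of_seedOn_of_seedOff hAt seedOn_six hOff

end Summit.BirchSwinnertonDyer.BirchSwinnertonDyer.Theorems.PrintCFram.HeegnerFieldSupply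

end
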